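import Summits.ABC.IUTFork.DAGL2a
import Summits.ABC.IUTFork.DAGL2b
import Summits.ABC.IUTFork.DAGL2p
import Summits.ABC.IUTFork.DAGL2q
import Summits.ABC.IUTFork.DAGL2r
import Summits.ABC.IUTFork.DAGL2u
import Summits.ABC.IUTFork.DAGL2v
import Summits.ABC.IUTFork.DAGUa
import HarnessLib

/-!
# L2 LAYER CERTIFICATE, part A — the [EtTh] §1–§2 members of the [IUTchIII] Cor 3.12 cone, packaged BY NAME over the kernel DAG index

abc-iut cell, director-abc 2026-08-26T05:19:55Z (C2) «each layer files `Conditional/Layer<k>OfS.lean` = the layer's nodes discharged modulo S +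
facts (a conjunction theorem), so the apex imports six certificates instead of 793 nodes»; C lead abc-iut-plan (plan/C/ABC-OF-S-SPEC.md §3);
shape = the L6 pattern of record (plan/L6/CERT-L6.md §1, conjunct conventions K1–K5, R-def (b); files `Conditional/Layer6OfS*.lean`,
`Conditional/Layer1OfSa.lean`, `Conditional/Layer4OfS{a,b}.lean`). Seat abc-iut-w6-d071 (wave W6, block C), row CERT-L2 (OFFER/CLAIM 06:58Z).
MAP of record: HOME/staging/w6/w6-d071/cert/CERT-L2-MAP-v0.tsv (mechanical: plan/CONE-BOARD.tsv @06:06:26Z L2 rows (= plan/COR312-CONE.tsv ∩ L2,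
105 nodes) × plan/DAG.tsv @06:00:22Z kernel_id/status × the index `Summits/ABC/IUTFork/DAGL2*.lean` (+ upgrade/extra parts DAGU*/DAGX*) of
abc-iut-c312-2). STATUS SOURCE = plan/DAG.tsv status (discharged / landed); the L2 lead's plan/L2/NODES.md (v @06:21Z) and
plan/L2/CONE-L2-STATUS.tsv v2.3 verdicts are carried PER LINE as a second tag («L2=…») and NEVER merged: where abc-iut-L2-lead rules that a
DAG-landed node is discharged, the row moves Residual → Discharged at the next version (the lead's word wins; this v0 moves nothing on its own).

THIS FILE PROVES NOTHING NEW AND ASSERTS NOTHING: every conjunct is an index Prop `N_<id>` (or an index discharge SUB-ROW Prop `N_<id>_<row>`)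
BY NAME, universe-instantiated with shared level names `u₁ … u₁₀` (positional: a conjunct's i-th universe parameter is `uᵢ`), and every witness
is the index's own `_holds` / `_part` term BY NAME — no tactic proof of content, no restatement, no new `def … : Prop` fact, no `instance`, no
schema ∀-closed. It PACKAGES the [EtTh] §1–§2 slice of the L2 cone into ONE discharged conjunction and ONE residual conjunction for the apex
`Conditional/AbcOfS` (via the top file `Conditional/Layer2OfS.lean`, filed when both parts have oleans).

COUNT LINE (split form «nodes = d + r + d_data + not-indexed»): **[EtTh] §1–§2 slice 53 = d 11 (DAG-discharged claim nodes; conjuncts of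
`Layer2DischargedA`, + 10 witnessed index discharge SUB-ROWS `N_<id>_<row>` with `_holds` that enter `Layer2DischargedA` next to their node,
K4-exception of the L6 grammar — the sub-DAG rows of Thm1.6(i), Cor2.18(i), Cor2.18(iii), Cor2.19(i), Cor2.19(iii)) + r 28 (Residual: DAG-landed claim
nodes = this slice's entries on the C scoreboard; conjuncts of `Layer2ResidualA`; 11 of them are FACT-policy nodes of plan/CONE-BOARD — bucket
«FACT (by name, never discharged)», tagged [FACT-policy] per line) + d_data 10 (K4: index data aliases `abbrev N_<id> := @decl` of definitions /
structures / FACT-style named Props — omitted from the conjunctions, NAME-CHECKED below as `example := @N_…`; DAG-discharged 2 · DAG-landed 8) +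
not-indexed 4 (K5: no `N_<id>` in the index at this stamp; listed; their `_holds` sub-rows ARE conjoined).  11 + 28 + 10 + 4 = 53.**
L2-LEAD VERDICT FLAGS (information for v1; CONE-L2-STATUS v2.3 «DISCHARGED…/PROVED…» on a DAG-landed claim node): 9 rows — Prop1.4(i), Prop1.4(ii), Prop1.8, Prop2.11(i), Prop2.11(ii), Prop2.15(i), Prop2.15(ii), Prop2.15(iii), Prop2.15(iv).
KERNEL NOTE (honest, as in the L6/L4/L1 certificates): every index claim Prop is a `StatementOf` conjunction of LANDED theorems, so each RESIDUAL
conjunct is ALSO kernel-inhabited by the index's `_part`; «discharged vs residual» is the DAG/NODES row STATUS (the judgement that the typed theorems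
cover the printed item), not kernel provability — r is a documented bookkeeping count; no residual conjunct is an open kernel obligation.
S consumed at L2: NO (S = `PilotKummerIndRelated` enters at the Cor 3.12 node, c312's layer). FACT-LIST inputs: the named facts bound INSIDE the
conjoined statements (instance forms) are those of the L2 lead's feeder plan/L2/CONE-L2-STATUS.tsv «residual» column; v0 does not re-census them
(inputs named, not endorsed).
HONEST FRAMING: typed ≠ proved; indexed ≠ endorsed; witnessed ≠ lead-discharged; nothing here asserts that abc is proved or refuted or takes a
side on [IUTchIII] Cor. 3.12. [claim: Mochizuki2012, status: disputed] (node texts: [EtTh] = Mochizuki, Publ. RIMS 45 (2009) 227–349). Version: v0 2026-08-26.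

d_data — K4 index data aliases (tag [data]); text = node · index alias · index part · DAG status · L2 verdict:
* EtTh:Prop1.1(i) [Proposition] [FACT-policy] — `N_EtTh_Prop1_1_i` (DAGL2p.lean); DAG landed(p406201); L2=fact-by-name (predicates on LineBundleData)
* EtTh:Prop1.1(ii) [Proposition] [FACT-policy] — `N_EtTh_Prop1_1_ii` (DAGL2p.lean); DAG landed(p406201); L2=fact-by-name (predicates on LineBundleData)
* EtTh:Lem1.2 [Lemma] — `N_EtTh_Lem1_2` (DAGL2p.lean); DAG landed(p406201); L2=fact-by-name (predicate on LineBundleData)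
* EtTh:Def1.9(i) [Definition] — `N_EtTh_Def1_9_i` (DAGL2p.lean); DAG discharged(p405265); L2=definition/DATA — nothing to discharge (ref-t DEFS lane)
* EtTh:Thm1.10(i) [Theorem] [FACT-policy] — `N_EtTh_Thm1_10_i` (DAGL2p.lean); DAG landed(p407956); L2=v2.0: SECOND closing route p422175 'MuTwoSetting.thm110iUnique_of_prop…
* EtTh:Thm1.10(ii) [Theorem] [FACT-policy] — `N_EtTh_Thm1_10_ii` (DAGL2p.lean); DAG landed(p407956); L2=see (i): V1″/V2′/G-rows | fact-by-name; (i) uniqueness PROVED mod V1″/…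
* EtTh:Thm1.10(iii) [Theorem] [FACT-policy] — `N_EtTh_Thm1_10_iii` (DAGL2p.lean); DAG landed(p407956); L2=v2.0: ROW (C) RE-TYPED p422027 over the GalSect Def 4.1 carrier (w5-d0…
* EtTh:Cor2.8(i) [Corollary] — `N_EtTh_Cor2_8_i` (DAGL2q.lean); DAG landed(p408233); L2=v1.8: REPAIR S1 ✓ S2 6/6 ✓ (p419600 p419377 p419607 p419611 p419630 p4…
* EtTh:Cor2.8(iii) [Corollary] — `N_EtTh_Cor2_8_iii` (DAGL2q.lean); DAG landed(p408233); L2=see Cor2.8(i) phase-1 defs | schema (FREE orbit fields) over the finit…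
* EtTh:Def2.13(iv) [Definition] — `N_EtTh_Def2_13_iv` (DAGL2q.lean); DAG discharged(p404894); L2=definition/DATA — nothing to discharge (ref-t DEFS lane)

not-indexed — K5 (no node-level `N_<id>` in `Summits/ABC/IUTFork/DAG*.lean` at this stamp; typed statement modules per plan/DAG.tsv):
* EtTh:Cor2.8(ii) [Corollary] — kernel_id `N_EtTh_Cor2_8_ii`; DAG landed(p408233); L2=v2.0: TYPED p421870 GalSectCuspPairTorsors (w5-d062 ROW (B), carrier o…
* EtTh:Cor2.19(i) [Corollary] [FACT-policy] — kernel_id `N_EtTh_Cor2_19_i`; DAG landed(p404894); L2=v2.0: L2-t11 g3 #3-R31 Sec5KummerGaloisDictionary (hgeom/hroot of the …; `_holds` sub-rows conjoined: `N_EtTh_Cor2_19_i_L01`, `N_EtTh_Cor2_19_i_L05`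
* EtTh:Cor2.19(ii) [Corollary] [FACT-policy] — kernel_id `N_EtTh_Cor2_19_ii`; DAG landed(p407825); L2=fact-by-name; PROVED-at-model mod facts
* EtTh:Cor2.19(iii) [Corollary] [FACT-policy] — kernel_id `N_EtTh_Cor2_19_iii`; DAG landed(p407825); L2=v1.8: [GalSect] ROW (A) COMPLETE p419620 ✓ p419967 ✓ p420496 ✓ (w5-d06…; `_holds` sub-rows conjoined: `N_EtTh_Cor2_19_iii_L02`, `N_EtTh_Cor2_19_iii_L03`
-/

namespace Summit.ABC.IUTFork.Conditional

open Summit.ABC.IUTFork.DAG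

universe u₁ u₂ u₃ u₄ u₅ u₆

/-- **L2 discharged, part A** ([EtTh] §1–§2): the index Props of the DAG-discharged cone nodes + the witnessed discharge sub-rows, BY NAME.
[claim: Mochizuki2012, status: disputed] -/
def Layer2DischargedA : Prop :=
  N_EtTh_Def1_7 -- EtTh:Def1.7 · DAG=discharged(p407956) · L2=v2.1: G-L2t6g4-3 orbit-generator clause — KERNEL INDEPENDENCE (w5-d140… · DAGL2p · `_holds` (DAGL2p)
  ∧ N_EtTh_Def1_9_ii.{u₁} -- EtTh:Def1.9(ii) · DAG=discharged(p404429) · L2=definition/DATA — nothing to discharge (ref-t DEFS lane) · DAGL2b · `_holds` (DAGL2b)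
  ∧ N_EtTh_Def2_1.{u₁} -- EtTh:Def2.1 · DAG=discharged(p405102) · L2=definition/DATA — nothing to discharge (ref-t DEFS lane) · DAGL2p · `_holds` (DAGL2p)
  ∧ N_EtTh_Def2_3.{u₁} -- EtTh:Def2.3 · DAG=discharged(p405102) · L2=definition/DATA — nothing to discharge (ref-t DEFS lane) · DAGL2p · `_holds` (DAGL2p)
  ∧ N_EtTh_Def2_5_i -- EtTh:Def2.5(i) · DAG=discharged(p406981) · L2=definition/DATA — nothing to discharge (ref-t DEFS lane) · DAGL2p · `_holds` (DAGL2p)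
  ∧ N_EtTh_Def2_5_ii.{u₁} -- EtTh:Def2.5(ii) · DAG=discharged(p407625) · L2=definition/DATA — nothing to discharge (ref-t DEFS lane) · DAGL2q · `_holds` (DAGL2q)
  ∧ N_EtTh_Def2_7.{u₁, u₂} -- EtTh:Def2.7 · DAG=discharged(p407625) · L2=v2.0: S3 (ThetaCovers v3 'isClosed_barKer', d3 g4) still BLOCKED on da… · DAGL2q · `_holds` (DAGL2q)
  ∧ N_EtTh_Def2_10.{u₁, u₂, u₃} -- EtTh:Def2.10 · DAG=discharged(p403739) · L2=definition/DATA — nothing to discharge (ref-t DEFS lane) · DAGL2a · `_holds` (DAGUa)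
  ∧ N_EtTh_Def2_13_i.{u₁} -- EtTh:Def2.13(i) · DAG=discharged(p404894) · L2=definition/DATA — nothing to discharge (ref-t DEFS lane) · DAGL2b · `_holds` (DAGL2b)
  ∧ N_EtTh_Def2_13_ii.{u₁, u₂, u₃} -- EtTh:Def2.13(ii) · DAG=discharged(p404894) · L2=definition/DATA — nothing to discharge (ref-t DEFS lane) · DAGL2q · `_holds` (DAGL2q)
  ∧ N_EtTh_Def2_13_iii.{u₁} -- EtTh:Def2.13(iii) · DAG=discharged(p404894) · L2=definition/DATA — nothing to discharge (ref-t DEFS lane) · DAGL2q · `_holds` (DAGL2q)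
  ∧ N_EtTh_Thm1_6_i_L00 -- sub-row of EtTh:Thm1.6(i) (node itself residual) · DAGL2v · `_holds`
  ∧ N_EtTh_Cor2_18_i_L05.{u₁} -- sub-row of EtTh:Cor2.18(i) (node itself residual) · DAGL2u · `_holds`
  ∧ N_EtTh_Cor2_18_iii_L01.{u₁, u₂} -- sub-row of EtTh:Cor2.18(iii) (node itself residual) · DAGL2u · `_holds`
  ∧ N_EtTh_Cor2_18_iii_L02.{u₁} -- sub-row of EtTh:Cor2.18(iii) (node itself residual) · DAGL2u · `_holds`
  ∧ N_EtTh_Cor2_18_iii_L03.{u₁} -- sub-row of EtTh:Cor2.18(iii) (node itself residual) · DAGL2u · `_holds`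
  ∧ N_EtTh_Cor2_18_iii_L04.{u₁} -- sub-row of EtTh:Cor2.18(iii) (node itself residual) · DAGL2u · `_holds`
  ∧ N_EtTh_Cor2_19_i_L01.{u₁} -- sub-row of EtTh:Cor2.19(i) (node itself not indexed) · DAGL2u · `_holds`
  ∧ N_EtTh_Cor2_19_i_L05.{u₁} -- sub-row of EtTh:Cor2.19(i) (node itself not indexed) · DAGL2u · `_holds`
  ∧ N_EtTh_Cor2_19_iii_L02.{u₁} -- sub-row of EtTh:Cor2.19(iii) (node itself not indexed) · DAGL2u · `_holds`
  ∧ N_EtTh_Cor2_19_iii_L03.{u₁} -- sub-row of EtTh:Cor2.19(iii) (node itself not indexed) · DAGL2u · `_holds`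

/-- `Layer2DischargedA` holds: the index witnesses BY NAME (nothing new). [claim: Mochizuki2012, status: disputed] -/
theorem layer2DischargedA_holds : Layer2DischargedA.{u₁, u₂, u₃} :=
  ⟨N_EtTh_Def1_7_holds,
    N_EtTh_Def1_9_ii_holds,
    N_EtTh_Def2_1_holds,
    N_EtTh_Def2_3_holds,
    N_EtTh_Def2_5_i_holds,
    N_EtTh_Def2_5_ii_holds,
    N_EtTh_Def2_7_holds,
    N_EtTh_Def2_10_holds,
    N_EtTh_Def2_13_i_holds,
    N_EtTh_Def2_13_ii_holds,
    N_EtTh_Def2_13_iii_holds,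
    N_EtTh_Thm1_6_i_L00_holds,
    N_EtTh_Cor2_18_i_L05_holds,
    N_EtTh_Cor2_18_iii_L01_holds,
    N_EtTh_Cor2_18_iii_L02_holds,
    N_EtTh_Cor2_18_iii_L03_holds,
    N_EtTh_Cor2_18_iii_L04_holds,
    N_EtTh_Cor2_19_i_L01_holds,
    N_EtTh_Cor2_19_i_L05_holds,
    N_EtTh_Cor2_19_iii_L02_holds,
    N_EtTh_Cor2_19_iii_L03_holds⟩

/-- **L2 residual, part A** ([EtTh] §1–§2): the index Props of the cone nodes the DAG does not (yet) mark discharged — the C-scoreboard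
entries of this slice (FACT-policy nodes tagged). [claim: Mochizuki2012, status: disputed] -/
def Layer2ResidualA : Prop :=
  N_EtTh_Prop1_3 -- EtTh:Prop1.3 · DAG=landed(p406190) · L2=fact-by-name; model supplies the class · DAGL2p · `_part` · [FACT-policy]
  ∧ N_EtTh_Prop1_4_i.{u₁} -- EtTh:Prop1.4(i) · DAG=landed(p403763) · L2=DISCHARGED at the level of points; ONE untyped formal-scheme sentence … · DAGL2a · `_part`
  ∧ N_EtTh_Prop1_4_ii.{u₁} -- EtTh:Prop1.4(ii) · DAG=landed(p403763) · L2=DISCHARGED (in-file theorems) · DAGL2a · `_part`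
  ∧ N_EtTh_Prop1_4_iii -- EtTh:Prop1.4(iii) · DAG=landed(p406645) · L2=v1.9: ROWS w5-d140 g2 = REPAIRED per-point VALUES decl + proof from la… · DAGL2p · `_part`
  ∧ N_EtTh_Thm1_6_i -- EtTh:Thm1.6(i) · DAG=landed(p406653) · L2=v2.0: ROOT MODEL p421399 ✓ + 'IsThm16Origin.tate2' INHABITED at ThetaS… · DAGL2p · `_part` · [FACT-policy]
  ∧ N_EtTh_Thm1_6_ii -- EtTh:Thm1.6(ii) · DAG=landed(p406653) · L2=fact-by-name + SUBDAG K3 COMPLETE to the honest floor (junction/glue P… · DAGL2p · `_part` · [FACT-policy]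
  ∧ N_EtTh_Thm1_6_iii -- EtTh:Thm1.6(iii) · DAG=landed(p406653) · L2=fact-by-name + SUBDAG K3 COMPLETE to the honest floor (junction/glue P… · DAGL2p · `_part` · [FACT-policy]
  ∧ N_EtTh_Prop1_8.{u₁, u₂} -- EtTh:Prop1.8 · DAG=landed(p407956) · L2=DISCHARGED-mod-Thm1.6-facts (t1 g2 §1 discharge files) · DAGL2p · `_part`
  ∧ N_EtTh_Prop2_2_i.{u₁} -- EtTh:Prop2.2(i) · DAG=landed(p405102) · L2=v2.1: hιtheta DISCHARGED p422670 ✓ 'ThetaSetting.PiCData.inv_theta_of_… · DAGL2p · `_part`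
  ∧ N_EtTh_Prop2_2_ii.{u₁} -- EtTh:Prop2.2(ii) · DAG=landed(p405102) · L2=v1.9: prop22_ii_ofSetting at the model (t10 g4, see Prop2.2(i)); L2-t7… · DAGL2p · `_part`
  ∧ N_EtTh_Prop2_2_iii.{u₁} -- EtTh:Prop2.2(iii) · DAG=landed(p405102) · L2=v1.9: prop22_iii_ofSetting at the model (t10 g4, axioms standard; see … · DAGL2p · `_part`
  ∧ N_EtTh_Prop2_4.{u₁} -- EtTh:Prop2.4 · DAG=landed(p407625) · L2=v1.9: G-L6d6-2 hP24 standing (binder of 'map_GtpYdduu_subgroupOf_eq_of… · DAGL2p · `_part`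
  ∧ N_EtTh_Prop2_6.{u₁} -- EtTh:Prop2.6 · DAG=landed(p407625) · L2=[F1: interface = finite-G_K abstraction until R1/R2] DISCHARGED-mod-na… · DAGL2q · `_part`
  ∧ N_EtTh_Cor2_9.{u₁} -- EtTh:Cor2.9 · DAG=landed(p407625) · L2=v1.9: (Rmk 2.9.2 rides with Cor2.8(ii) row (B), w5-d062 g2 GO 04:17Z R… · DAGL2q · `_part`
  ∧ N_EtTh_Prop2_11_i.{u₁, u₂, u₃, u₄, u₅, u₆} -- EtTh:Prop2.11(i) · DAG=landed(p403739) · L2=DISCHARGED (in-file theorems) · DAGL2a · `_part`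
  ∧ N_EtTh_Prop2_11_ii.{u₁, u₂, u₃} -- EtTh:Prop2.11(ii) · DAG=landed(p407825) · L2=DISCHARGED (in-file theorems) · DAGL2q · `_part`
  ∧ N_EtTh_Prop2_14_i.{u₁} -- EtTh:Prop2.14(i) · DAG=landed(p404894) · L2=fact-by-name · DAGL2q · `_part` · [FACT-policy]
  ∧ N_EtTh_Prop2_14_ii.{u₁, u₂, u₃} -- EtTh:Prop2.14(ii) · DAG=landed(p403739) · L2=fact-by-name; PROVED-at-model · DAGL2a · `_part` · [FACT-policy]
  ∧ N_EtTh_Prop2_14_iii.{u₁} -- EtTh:Prop2.14(iii) · DAG=landed(p404894) · L2=v2.1: translation parts DISCHARGED-AT-MODEL mod Prop 1.5 (ii)(iii) nam… · DAGL2q · `_part` · [FACT-policy]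
  ∧ N_EtTh_Prop2_15_i -- EtTh:Prop2.15(i) · DAG=landed(p403826) · L2=DISCHARGED (in-file theorems) · DAGL2q · `_part`
  ∧ N_EtTh_Prop2_15_ii -- EtTh:Prop2.15(ii) · DAG=landed(p403826) · L2=DISCHARGED (in-file theorems) · DAGL2q · `_part`
  ∧ N_EtTh_Prop2_15_iii -- EtTh:Prop2.15(iii) · DAG=landed(p403826) · L2=DISCHARGED (in-file theorems) · DAGL2q · `_part`
  ∧ N_EtTh_Prop2_15_iv -- EtTh:Prop2.15(iv) · DAG=landed(p403826) · L2=DISCHARGED (in-file theorems) · DAGL2q · `_part`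
  ∧ N_EtTh_Cor2_16.{u₁} -- EtTh:Cor2.16 · DAG=landed(p407825) · L2=v1.9: Discharge/Sec2Cor216OfModel.lean in tree (t2 g3) → DISCHARGED-FO… · DAGL2q · `_part`
  ∧ N_EtTh_Cor2_18_i.{u₁} -- EtTh:Cor2.18(i) · DAG=landed(p404894) · L2=ROW #2 DELIVERED p420155 ✓ Sec2Cor218iModel (L6-d6 g3; 'rigidData_cor2… · DAGL2q · `_part` · [FACT-policy]
  ∧ N_EtTh_Cor2_18_ii -- EtTh:Cor2.18(ii) · DAG=landed(p404753) · L2=fact-by-name; PROVED-at-model · DAGL2q · `_part` · [FACT-policy]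
  ∧ N_EtTh_Cor2_18_iii.{u₁} -- EtTh:Cor2.18(iii) · DAG=landed(p406647) · L2=fact-by-name; conditional discharge · DAGL2r · `_part` · [FACT-policy]
  ∧ N_EtTh_Cor2_18_iv.{u₁} -- EtTh:Cor2.18(iv) · DAG=landed(p406647) · L2=fact-by-name; DISCHARGED-mod-named-inputs (all levels) · DAGL2r · `_part` · [FACT-policy]

/-- KERNEL NOTE made checkable: `Layer2ResidualA` is inhabited by the index's partial witnesses BY NAME — residual = bookkeeping status, not an
open kernel obligation. [claim: Mochizuki2012, status: disputed] -/
theorem layer2ResidualA_inhabited : Layer2ResidualA.{u₁, u₂, u₃, u₄, u₅, u₆} :=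
  ⟨N_EtTh_Prop1_3_part,
    N_EtTh_Prop1_4_i_part,
    N_EtTh_Prop1_4_ii_part,
    N_EtTh_Prop1_4_iii_part,
    N_EtTh_Thm1_6_i_part,
    N_EtTh_Thm1_6_ii_part,
    N_EtTh_Thm1_6_iii_part,
    N_EtTh_Prop1_8_part,
    N_EtTh_Prop2_2_i_part,
    N_EtTh_Prop2_2_ii_part,
    N_EtTh_Prop2_2_iii_part,
    N_EtTh_Prop2_4_part,
    N_EtTh_Prop2_6_part,
    N_EtTh_Cor2_9_part,
    N_EtTh_Prop2_11_i_part,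
    N_EtTh_Prop2_11_ii_part,
    N_EtTh_Prop2_14_i_part,
    N_EtTh_Prop2_14_ii_part,
    N_EtTh_Prop2_14_iii_part,
    N_EtTh_Prop2_15_i_part,
    N_EtTh_Prop2_15_ii_part,
    N_EtTh_Prop2_15_iii_part,
    N_EtTh_Prop2_15_iv_part,
    N_EtTh_Cor2_16_part,
    N_EtTh_Cor2_18_i_part,
    N_EtTh_Cor2_18_ii_part,
    N_EtTh_Cor2_18_iii_part,
    N_EtTh_Cor2_18_iv_part⟩

/-- The [EtTh] §1–§2 slice of the L2 cone: discharged ∧ residual. [claim: Mochizuki2012, status: disputed] -/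
def Layer2ConeA : Prop :=
  Layer2DischargedA.{u₁, u₂, u₃} ∧ Layer2ResidualA.{u₁, u₂, u₃, u₄, u₅, u₆}

/-- The slice follows from its residual alone (the discharged half is witnessed BY NAME). [claim: Mochizuki2012, status: disputed] -/
theorem layer2ConeA_of (h : Layer2ResidualA.{u₁, u₂, u₃, u₄, u₅, u₆}) : Layer2ConeA.{u₁, u₂, u₃, u₄, u₅, u₆} :=
  ⟨layer2DischargedA_holds.{u₁, u₂, u₃}, h⟩

/-- KERNEL NOTE made checkable at slice level: `Layer2ConeA` is inhabited outright (discharged half by `_holds`, residual half by `_part`);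
«residual» is a STATUS label of the DAG/NODES rows, not an open kernel obligation. [claim: Mochizuki2012, status: disputed] -/
theorem layer2ConeA_inhabited : Layer2ConeA.{u₁, u₂, u₃, u₄, u₅, u₆} :=
  layer2ConeA_of layer2ResidualA_inhabited.{u₁, u₂, u₃, u₄, u₅, u₆}

/-! ### d_data rows and not-indexed nodes — NAME-CHECKED ONLY (the build breaks if an index name drifts; no Prop is asserted) -/
example := @N_EtTh_Prop1_1_i -- EtTh:Prop1.1(i) [data-form, listed] [FACT-policy]
example := @N_EtTh_Prop1_1_ii -- EtTh:Prop1.1(ii) [data-form, listed] [FACT-policy]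
example := @N_EtTh_Lem1_2 -- EtTh:Lem1.2 [data-form, listed]
example := @N_EtTh_Def1_9_i -- EtTh:Def1.9(i) [data-form, listed]
example := @N_EtTh_Thm1_10_i -- EtTh:Thm1.10(i) [data-form, listed] [FACT-policy]
example := @N_EtTh_Thm1_10_ii -- EtTh:Thm1.10(ii) [data-form, listed] [FACT-policy]
example := @N_EtTh_Thm1_10_iii -- EtTh:Thm1.10(iii) [data-form, listed] [FACT-policy]
example := @N_EtTh_Cor2_8_i -- EtTh:Cor2.8(i) [data-form, listed]
example := @N_EtTh_Cor2_8_iii -- EtTh:Cor2.8(iii) [data-form, listed]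
example := @N_EtTh_Def2_13_iv -- EtTh:Def2.13(iv) [data-form, listed]

end Summit.ABC.IUTFork.Conditional
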